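import Summits.BirchSwinnertonDyer.BirchSwinnertonDyer.Theorems.ClassRecordThreeEulerHalvesAtThreeKolyvaginFamilyLevelSupplyClosing
import Summits.BirchSwinnertonDyer.BirchSwinnertonDyer.Theorems.ClassRecordThreeCornerAtThreeShimuraWalkB6DDefs
import Summits.BirchSwinnertonDyer.BirchSwinnertonDyer.Theorems.ClassRecordThreeCornerAtThreeShimuraFamilyProducersLocal
import Summits.BirchSwinnertonDyer.BirchSwinnertonDyer.Theorems.ClassRecordThreeCornerAtThreeShimuraFamilyH47Orders
import Summits.BirchSwinnertonDyer.BirchSwinnertonDyer.Theorems.Rank1ResidualJetRingClassFields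
import Summits.BirchSwinnertonDyer.BirchSwinnertonDyer.Theorems.ClassRecordThreeEulerHalvesAtThreeShimuraFamilyProducersLocalTamagawa
import Summits.BirchSwinnertonDyer.BirchSwinnertonDyer.Theorems.ClassRecordThreeEulerHalvesAtThreeShimuraWalkB6TDDefs
import Literature.NumberTheory.EllipticCurves.UnramifiedClassTamagawaTorsion
import HarnessLib

/-!
# PORT TARGET 2 ON THE B6TD FRAME, CLOSED MODULO POITOU–TATE AND MILNE I.3.8:
# `Milne2006_localTamagawaNumber_smul_unramifiedClass_eq_zero → (∀ K, PT K) → ShimuraWalk.LevelSupplyAtThreeB6TD`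
# — the ported Jetchev walk for the labelled CM family of `X_{N⁺,N⁻}` with the label (B6) asked ONLY AT THE CARRIER PRIMES outside `S`
# (cell `bsd-stepL`, seat `bsd-stepL-tam3-p1` g15, LINE OWNER of crux 19109 `EulerHalvesAtThree`; `--supports stmt-BirchSwinnertonDyer-19109 --as helper`;
# the frame is shared with crux 21420 `CornerAtThreeW`)

WHAT. `ShimuraWalk.levelSupplyAtThreeB6TD_of_milne_of_poitouTate`: tam3-p1 g14's p606391 (`levelSupplyAtThreeB6D_of_poitouTate`: the
(B6)-keyed per-level inequality of the carrier-inert Shimura road at `3` on the restricted frame `d_K < −4` — Jetchev 2008 Thm. 6.3 ∘ Prop. 6.4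
per conductor — from Poitou–Tate duality, THIS seat's end-game composition `Koly.levelSupplyAt_three_of_labels_of_familyProducers` (p605065)
with lane B's four ∀-datum producers plugged in) RE-RUN with the identity-component label (B6) asked only at the CARRIER primes outside `S`
(`∀ q [Fact q.Prime], q ∣ N → q ∉ S → 3 ∣ c_q(E/ℚ_q) → LabelB6 ι W N {q} ys`): the two producers that consumed (B6) are now tam3-p1 g15's
Tamagawa-keyed ones (p615952) — `hSel` = `kolyvaginClass_familyData_mem_selmerLocalKer_of_labelsAt_of_tamagawa` (receptacle at the carrier
places, Milne *ADT* I Prop. 3.8 — the cite-only Literature fact `Milne2006_localTamagawaNumber_smul_unramifiedClass_eq_zero`, p614601, taken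
as the hypothesis `hM` — at the Tamagawa-free bad places) and `hstrq` = `localization_kolyvaginClass_familyData_mem_stringentFamily_of_labelB6_singleton`
at the exempted carrier `q` from its OWN singleton label (available because the branch is `ord₃ c_q(E/ℚ_q) ≥ 1`, i.e. `3 ∣ c_q`). Everything
else is p606391's text VERBATIM. Conclusion = the B6TD port target `ShimuraWalk.LevelSupplyAtThreeB6TD` (tam3-p1 g15's `…ShimuraWalkB6TDDefs`),
STRONGER than the B6D one.
HONEST FRAMING. ONE theorem, CONDITIONAL on `hM` (Milne ADT I Prop. 3.8, general form; printed, cite-only) and `hPT` (Milne ADT I Thm. 4.10,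
Cassels–Fröhlich VII §11; citable); it does NOT discharge any registered stub; nothing about BSD, `J₃` or any divisibility of a Heegner point
is asserted unconditionally; no item closes; 0 classes move (T7); BSD is not proved by any of this.
References (locators only): [cite: Jetchev2008, Thm. 1.4, §6 Thm. 6.3, Prop. 6.4, Prop. 4.9] [cite: GrossLMS1991, Prop. 5.4, §6 Prop. 6.2 (1)]
[cite: McCallumLMS1991, §4 Prop. 4.4] [cite: MilneADT2006, Ch. I, Prop. 3.8, Thm. 4.10] [cite: CasselsFrohlichANT1967, Ch. VII Prop. 1.2 (ii), §11]
[cite: SilvermanAEC2009, VII.2 remark after Prop. 2.1].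
presearch: not applicable (composition of tree theorems). Design: `K : Type`. Axioms: `propext`, `Classical.choice`, `Quot.sound`.
-/

set_option autoImplicit false
set_option linter.dupNamespace false

noncomputable section

open scoped Classical NumberField Pointwise

namespace Summit.BirchSwinnertonDyer.BirchSwinnertonDyer.Theorems.ShimuraWalk

open WeierstrassCurve IsDedekindDomain NumberField Field Function Literature.NumberTheory.EllipticCurves
  Literature.NumberTheory.EllipticCurves.ModularForms Literature.NumberTheory.EllipticCurves.Jetchev2008
  Literature.NumberTheory.EllipticCurves.KolyvaginCocycle
  Literature.NumberTheory.EllipticCurves.Rank1Residual Literature.NumberTheory.GaloisRepresentations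
  Literature.NumberTheory.GaloisCohomology Literature.NumberTheory.Automorphic
  Summit.BirchSwinnertonDyer.Rank1Residual.JET Summit.BirchSwinnertonDyer.Rank1Residual.JET.SelmerVocabulary
  Summit.BirchSwinnertonDyer.Rank1Residual.JET.Walk Summit.BirchSwinnertonDyer.Rank1Residual.JET.GlobalDuality
  Summit.BirchSwinnertonDyer.Rank1Residual.X11b Summit.BirchSwinnertonDyer.Rank1Residual.X11b.Three
  Summit.BirchSwinnertonDyer.BirchSwinnertonDyer.Theorems
  Literature.NumberTheory.EllipticCurves.ShimuraCMFamily

set_option maxHeartbeats 800000 in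
/-- **`Milne I.3.8 → (∀ K, PT K) → ShimuraWalk.LevelSupplyAtThreeB6TD`** — the per-level inequality of the carrier-inert Shimura road at `3`
on the restricted frame `d_K < −4` with (B6) ONLY AT THE CARRIER primes outside `S`: p606391's end-game composition
`Koly.levelSupplyAt_three_of_labels_of_familyProducers` with `hsign`, `h47` (lane B) and the Tamagawa-keyed `hSel` ∕ singleton-label `hstrq`
(tam3-p1 g15) plugged in; in the branch `ord₃ c_q ≥ 1` the exempted `q` IS a carrier, so its own singleton label is available from `hB6T`.
The intended body of r11's `stub_levelSupplyAtThree`.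
[cite: Jetchev2008, Thm. 1.4, Thm. 6.3, Prop. 6.4, Prop. 4.9] [cite: GrossLMS1991, Prop. 5.4, §6 Prop. 6.2 (1)]
[cite: McCallumLMS1991, §4 Prop. 4.4] [cite: MilneADT2006, Ch. I, Thm. 4.10] [cite: CasselsFrohlichANT1967, Ch. VII Prop. 1.2 (ii)] -/
theorem levelSupplyAtThreeB6TD_of_milne_of_poitouTate
    (hM : Literature.NumberTheory.EllipticCurves.Milne2006_localTamagawaNumber_smul_unramifiedClass_eq_zero.{0})
    (hPT : ∀ (K : Type) [Field K] [NumberField K], poitouTate_selmerStructure_duality_conj K) :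
    LevelSupplyAtThreeB6TD := by
  intro W _ _ N _ K _ _ S Dt X W' _ P₀ hN hirr hK hD _hS hin hsp h3S _hc _hmin ι y ys ε hL hB6T q _ hqS
  subst hN
  haveI : ∀ j : ℕ, NumberField (ringClassField K ι j) := numberField_ringClassField K hK ι
  haveI : (W.baseChange K).IsElliptic := inferInstanceAs (W.map (algebraMap ℚ K)).IsElliptic
  -- Milne ADT I Prop. 3.8 for `E/K` at every finite place (the displayed `hM38` of the Tamagawa-keyed producers)
  have hM38 : ∀ (v : HeightOneSpectrum (𝓞 K)) {𝔐 : Ideal (v.localAbsIntegers)}, 𝔐 ∈ v.localPrimesAbove →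
      ∀ f : contOneCocycles (discreteTopRep (absoluteGaloisGroup (v.adicCompletion K))
          (localPoints (W.baseChange K) (v.adicCompletion K))),
        (∀ σ ∈ 𝔐.inertia (absoluteGaloisGroup (v.adicCompletion K)), f.1 σ = 0) →
        (((W.baseChange K).baseChange (v.adicCompletion K)).localTamagawaNumber (v.adicCompletionIntegers K) : ℤ) •
          oneCocycleClass (discreteTopRep (absoluteGaloisGroup (v.adicCompletion K))
            (localPoints (W.baseChange K) (v.adicCompletion K))) f = 0 :=
    fun v _ h𝔐 f hf ↦ hM (W.baseChange K) v h𝔐 f hf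
  have hp : (3 : ℕ).Prime := Fact.out
  have hp2 : (3 : ℕ) ≠ 2 := by decide
  have hq : q.Prime := Fact.out
  -- the trivial case `t = 0`
  rcases Nat.eq_zero_or_pos (padicValNat 3 ((W.baseChange ℚ_[q]).localTamagawaNumber ℤ_[q])) with ht0 | htpos
  · rw [ht0]
    intro k c _ _ _
    simp
  -- `3 ∣ c_q`, so `q` is a bad prime: `q ∣ N`
  obtain ⟨vq, hqq⟩ : ∃ v : HeightOneSpectrum (𝓞 ℚ), (Rat.HeightOneSpectrum.primesEquiv v : ℕ) = q :=
    ⟨Rat.HeightOneSpectrum.primesEquiv.symm ⟨q, Fact.out⟩, by rw [Equiv.apply_symm_apply]⟩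
  have hcq : (W.baseChange ℚ_[q]).localTamagawaNumber ℤ_[q] = W.tamagawaNumberAt vq :=
    WeierstrassCurve.localTamagawaNumber_padic_eq_holds W vq q hqq
  have hc1 : (W.baseChange ℚ_[q]).localTamagawaNumber ℤ_[q] ≠ 1 := fun h1 ↦ by
    rw [h1, padicValNat_one_right] at htpos
    exact lt_irrefl 0 htpos
  have hbad : ¬ W.HasGoodReductionAt vq := fun hgood ↦
    hc1 (hcq.trans (WeierstrassCurve.localTamagawaNumber_eq_one_of_hasGoodReductionAt_holds W vq hgood))
  have hqN : q ∣ W.conductorNorm ℤ := by rw [← hqq]; exact (W.dvd_conductorNorm_iff vq).mpr hbad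
  have hq2 := hsp q hq hqN hqS
  -- `3 ∣ c_q(E/ℚ_q)`: the exempted prime IS a carrier, so its singleton label (B6) is available
  have h3cq : 3 ∣ (W.baseChange ℚ_[q]).localTamagawaNumber ℤ_[q] := by
    by_contra h3
    rw [padicValNat.eq_zero_of_not_dvd h3] at htpos
    exact lt_irrefl 0 htpos
  have hB6q : LabelB6 ι W (W.conductorNorm ℤ) {q} ys := hB6T q hqN hqS h3cq
  -- `Gal(K/ℚ) = {1, τ}`
  haveI : Algebra.IsQuadraticExtension ℚ K := ⟨hK.1⟩
  have hcard : Nat.card (K ≃ₐ[ℚ] K) = 2 := by rw [IsGalois.card_aut_eq_finrank, hK.1]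
  obtain ⟨τ, hτ, huniq⟩ := (Nat.card_eq_two_iff' (1 : K ≃ₐ[ℚ] K)).mp hcard
  have hτ2 : τ * τ = 1 := by
    rw [mul_eq_one_iff_eq_inv]
    exact (huniq τ⁻¹ (inv_ne_one.mpr hτ)).symm
  -- every place `v ∋ q` of `K` is moved by `τ` and is BAD for `E/K` (`c_v = c_q ≠ 1`)
  obtain ⟨v₀, hv₀, -, hqv₀⟩ := exists_split_place_of_ncard_eq_two K hK τ hτ q hq2 hqN
  have hbadK : ∀ v : HeightOneSpectrum (𝓞 K), ((q : ℕ) : 𝓞 K) ∈ v.asIdeal →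
      ¬ (W.baseChange K).HasGoodReductionAt v := by
    intro v hqv hgood
    obtain ⟨σ, hσ⟩ := HeightOneSpectrum.exists_algEquiv_smul_eq (F := ℚ) (w := v₀) (w' := v)
      (LocalField.heightOneSpectrum_rat_eq_of_natCast_mem q _ _
        (LocalField.natCast_mem_under q v₀ hqv₀) (LocalField.natCast_mem_under q v hqv))
    have hτv : τ • v ≠ v := by
      by_cases hσ1 : σ = 1
      · subst hσ1
        rw [one_smul] at hσ
        subst hσ
        exact hv₀
      · have hστ : σ = τ := huniq σ hσ1
        subst hστ
        subst hσ
        rw [smul_smul, hτ2, one_smul]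
        exact fun h ↦ hv₀ h.symm
    obtain ⟨-, -, hcEq, -, -⟩ := carrierRowData_of_split W K q hK τ v hτv hqv
    exact hc1 (hcEq.symm.trans
      ((W.baseChange K).localTamagawaNumber_eq_one_of_hasGoodReductionAt_holds v hgood))
  -- `3` is unramified in `K` (`3 ∈ S`), the Weil pairing; admissibility of `E(K[n])` for every datum (`E[3]` irreducible)
  have hKunr := ShimuraKolyvaginOfImage.isUnramifiedIn_rat_of_not_dvd_discr K hp (hin 3 h3S).2.2.2.2
  have hW3 := WeierstrassCurve.exists_weilPairing_holds W 3
  have hA : ∀ (n : ℕ) (d : KolyvaginFamilyData W K ι n), d.y = ys n → Squarefree n →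
      (∀ q' ∈ n.primeFactors, IsKolyvaginPrime (W.conductorNorm ℤ) W K 3 q') →
      ∀ j : ℕ, IsAdmissible (absoluteGaloisGroup K) d.pointsSubgroup ((3 ^ j : ℕ) : ℤ) :=
    fun n d _ hn hKP j ↦ d.isAdmissible_pointsSubgroup_family_of_hasIrreducibleModPGaloisRep hK hn.ne_zero hp hp2
      hirr hW3 hKunr (fun h3n ↦ (hKP 3 (Nat.mem_primeFactors.mpr ⟨hp, h3n, hn.ne_zero⟩)).2.2.2.1 rfl) j
  -- the END-GAME composition with lane B's producers plugged in
  exact Koly.levelSupplyAt_three_of_labels_of_familyProducers W (W.conductorNorm ℤ) K S Dt rfl hirr hK hD hin hsp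
    h3S ι hPT y ys ε hL q hqS
    (fun c hc n d hdy hn hKol j hj hjM ↦
      pointsMap_derivedPoint_familyData_of_labelsAt hK ι Dt hp ys hL hA hc (isLiftOfAut_liftAut c) n d hdy hn
        hKol j hj hjM)
    (fun M n d hMn hdy hn hKol 𝔳 h𝔳 ↦
      kolyvaginClass_familyData_mem_selmerLocalKer_of_labelsAt_of_tamagawa hK ι rfl Dt hirr hin hsp ys hL hB6T hM38 hA M n d hMn
        hdy hn hKol 𝔳 h𝔳)
    (fun k hn' n d hk hdy hn hKol _ v hqv ↦
      localization_kolyvaginClass_familyData_mem_stringentFamily_of_labelB6_singleton hK ι Dt hirr hsp ys hL q hqN hqS hB6q hA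
        k hn' n d hk hdy hn hKol v hqv (hbadK v hqv))
    (fun k n n' d d' ℓ hk hdy hd'y hn hKol hℓ hℓn hn' v hv ↦
      addOrderOf_localization_kolyvaginClass_familyData_eq_of_labels_of_admissible hK hD ι rfl hp2 Dt ys hL hA
        k n n' d d' ℓ hk hdy hd'y hn hKol hℓ hℓn hn' v hv)

end Summit.BirchSwinnertonDyer.BirchSwinnertonDyer.Theorems.ShimuraWalk

end
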